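import Summits.ResolutionOfSingularities.ResolutionOfSingularities.Theorems.WeightedInvariantAQSBaseChangeDescent
import Summits.ResolutionOfSingularities.ResolutionOfSingularities.Theorems.AQSHeightTwoSlopeCompare
import Summits.ResolutionOfSingularities.ResolutionOfSingularities.Theorems.AQSHeightTwoWeightedContactUnique
import Literature.AlgebraicGeometry.Resolution.HypersurfaceHeightTwoWeightedCentre
import HarnessLib

/-!
# Preliminaries for the separable base change of the lex-maximal centre: level, contraction, steeper pieces

Route `ResolutionOfSingularities/WeightedInvariant`, door crux `HypersurfaceCentreConstruction`
(stmt-ResolutionOfSingularities-19897) — OURS, helper; e-ladder `e = 1`, piece **(o25-δ)** (res-D-pv-025 AS stub-10), brick (δ1c),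
part 1 of 2 (split for the 400-line rule; part 2 = `…AQSBaseChangeLexMax`):

* `span_pow_sup_le_steeper` — `(z^ν) + 𝒥((x,z);(1,b); bν+1) ⊆ 𝒥((x,z);(ν, bν+1); (bν+1)ν)`: the steeper ADMISSIBLE datum produced by a
  descended steepening;
* `level_eq` — for a lex-maximal germ `(x; w; ℓ)` of `(f)`: `ℓ = w 0 · ν` with `f ∈ 𝔪^ν ∖ 𝔪^{ν+1}`;
* `mem_weightedMonomialIdeal_of_map` — contraction of weighted monomial ideals along a faithfully flat `φ`
  (`Ideal.comap_map_eq_self_of_faithfullyFlat`).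

Def-free; nothing here is a claim about Hironaka's problem.  AI-written; weaker than expert review.
[cite: AbramovichQuekSchober2025, Def. 3.2–3.3, Thm 3.5]
-/

noncomputable section

set_option linter.dupNamespace false -- mandated namespace of this single-conjunct summit

namespace Summit.ResolutionOfSingularities.ResolutionOfSingularities.Theorems.AQSBaseChange

open IsLocalRing Literature.AlgebraicGeometry.Resolution
open Summit.ResolutionOfSingularities.ResolutionOfSingularities.Theorems.AQSHeightTwo

universe u v

/-! ## Small tools -/

section Tools

variable {S : Type u} [CommRing S]

/-- `(x, z; 1, b)`-pieces from level `bν + 1` on, and `z^ν`, lie in the STEEPER piece `𝒥((x,z);(ν, bν+1); (bν+1)ν)`.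
[folklore] -/
theorem span_pow_sup_le_steeper (x z : S) {b ν : ℕ} (hν : 1 ≤ ν) :
    Ideal.span {z ^ ν} ⊔ weightedMonomialIdeal ![x, z] ![1, b] (b * ν + 1) ≤
      weightedMonomialIdeal ![x, z] ![ν, b * ν + 1] ((b * ν + 1) * ν) := by
  refine sup_le ?_ ?_
  · rw [Ideal.span_singleton_le_iff_mem]
    have := monomial_mem x z ν (b * ν + 1) (i := 0) (j := ν) (n := (b * ν + 1) * ν) (by ring_nf; omega)
    rwa [pow_zero, one_mul] at this
  · refine weightedMonomialIdeal_two_le fun i j hij => monomial_mem x z ν (b * ν + 1) ?_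
    rw [one_mul] at hij
    rcases Nat.lt_or_ge j ν with hj | hj
    · have h1 := Nat.mul_le_mul_left ν hij
      nlinarith
    · nlinarith

/-- A unit factor on the second generator: `(x, u y) = (x, y)`. [folklore] -/
theorem span_pair_unit_mul_right (x y : S) {u : S} (hu : IsUnit u) : Ideal.span {x, u * y} = Ideal.span {x, y} := by
  rw [Ideal.span_insert, Ideal.span_singleton_mul_left_unit hu, ← Ideal.span_insert]

end Tools

/-! ## The level of a lex-maximal germ is `ν · w₀` with `ν` the order -/

section Level

variable {S : Type} [CommRing S] [IsLocalRing S]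

/-- The `(q,r)`-piece of level `rν` lies in `𝔪^ν` (`q ≤ r`). [folklore] -/
theorem weightedMonomialIdeal_le_pow {x y : S} (hx : x ∈ maximalIdeal S) (hy : y ∈ maximalIdeal S)
    {q r : ℕ} (hq : 0 < q) (hqr : q ≤ r) (ν : ℕ) :
    weightedMonomialIdeal ![x, y] ![q, r] (r * ν) ≤ maximalIdeal S ^ ν := by
  refine weightedMonomialIdeal_two_le fun i j hij => ?_
  have hij' : ν ≤ i + j := by
    by_contra h
    push Not at h
    have : q * i + r * j ≤ r * (i + j) := by nlinarith
    have : r * (i + j) < r * ν := Nat.mul_lt_mul_of_pos_left h (hq.trans_le hqr)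
    omega
  exact Ideal.pow_le_pow_right hij' (by rw [pow_add]; exact Ideal.mul_mem_mul (Ideal.pow_mem_pow hx i) (Ideal.pow_mem_pow hy j))

/-- **The level of a lex-maximal germ**: `ℓ = w 0 · ν` where `f ∈ 𝔪^ν ∖ 𝔪^{ν+1}` (the datum `(x; (1,1); ν)` is admissible, and
no datum of first invariant `> ord f` is). [cite: AbramovichQuekSchober2025, Def. 3.2–3.3] -/
theorem level_eq {f : S} {x : Fin 2 → S} {w : Fin 2 → ℕ} {ℓ : ℕ}
    (h : IsLexMaxWeightedCentreGerm S (Ideal.span {f}) x w ℓ) :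
    ∃ ν : ℕ, 1 ≤ ν ∧ ℓ = w 0 * ν ∧ f ∈ maximalIdeal S ^ ν ∧ f ∉ maximalIdeal S ^ (ν + 1) := by
  obtain ⟨hspan, hpos, -, hle, hℓ, ⟨ν, hν⟩, hadm, hmax, -⟩ := h
  have hx : ∀ i, x i ∈ maximalIdeal S := fun i => hspan ▸ Ideal.subset_span ⟨i, rfl⟩
  have hνpos : 1 ≤ ν := by
    rcases Nat.eq_zero_or_pos ν with rfl | hν'
    · rw [mul_zero] at hν; omega
    · exact hν'
  refine ⟨ν, hνpos, hν, ?_, ?_⟩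
  · -- `𝒥_{w₀ ν}(x; w) ⊆ 𝔪^ν`
    have hf : f ∈ weightedMonomialIdeal x w ℓ := (Ideal.span_singleton_le_iff_mem _).mp hadm
    have hxv : x = ![x 0, x 1] := by funext i; fin_cases i <;> rfl
    have hwv : w = ![w 0, w 1] := by funext i; fin_cases i <;> rfl
    rw [hxv, hwv, weightedMonomialIdeal_swap, hν] at hf
    exact weightedMonomialIdeal_le_pow (hx 1) (hx 0) (hpos 1) hle ν hf
  · -- the datum `(x; (1,1); ν+1)` would be lexicographically larger
    intro hf
    have hJ : Ideal.span {f} ≤ weightedMonomialIdeal x (fun _ => 1) (ν + 1) := by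
      rw [Ideal.span_singleton_le_iff_mem, LocalGameEFTNewton.weightedMonomialIdeal_const_one_eq_pow x hspan]
      exact hf
    rcases hmax x (fun _ => 1) (ν + 1) hspan (fun _ => Nat.one_pos) le_rfl (Nat.succ_pos ν) hJ with hlt | ⟨heq, -⟩
    · rw [hν] at hlt; nlinarith
    · rw [hν] at heq; nlinarith [hpos 0]

end Level

end Summit.ResolutionOfSingularities.ResolutionOfSingularities.Theorems.AQSBaseChange

end
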